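import Literature.AlgebraicGeometry.ShimuraVarieties.UnitaryBallLieDerivative
import Literature.Geometry.ComplexHyperbolic.UnitBallIsotropyCharacter
import Literature.Geometry.ComplexHyperbolic.UnitBallBounds
import Literature.Analysis.Complex.SeveralVariables
import Mathlib.Analysis.SpecialFunctions.Exponential
import HarnessLib

/-!
# FLOOR-0 P2a · B4-ARCHIMEDEAN DESK, line 2 `F0_P2aCohIsotypicLine` — support L2b (i): group functions of HOLOMORPHIC ball functions are
# SMOOTH in the archimedean variable on `U(2,1)`, and so are all their iterated Lie derivatives (the matrix-chart class `Ψ ∘ mat`)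

Cell hodgecm-mathlib (D-0151), FLOOR 0; crux item H413 = stmt-HodgeConjecture-24833 (route `HCCMUnconditional`); line
`Cruxes/H413/Lines/F0_P2aCohIsotypicLine.lean` (F0P2a-plan (g2), sha16 fe64be0a9875628f), seat F0P2a-p03 (g0), desk support **L2b**
(PLAN-P2a v2 §1 / §3: «CR dictionary + smooth-vector classes of hol forms incl. `IsHolGerm` + `K`-type ⇒ smooth along `ι_∞`»; the input `hsm`
(and, through continuity, `hbd`/`hrep`) of ★ `closure_l2OfForms_exp_invariant_of_analytic` for the `U(𝔤)`-span of the coordinates of a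
holomorphic cotangent form, sub-lemma of S2⁺ `stub_archOrth_hol`).  THEOREMS ONLY (no `def`, no instance, no notation, no named fact, no
`sorry`); `--supports stmt-HodgeConjecture-24833`.  HC_CM is proved only modulo the 7 printed citations until rung 0 closes; this file discharges none.

## What is proved (all on `U(2,1) = BallModel.U21`, `H := BallForms.u21Group`, `ι := MonoidHom.id`)
★ `UnitaryBallLieDerivative` / `UnitaryBallCauchyRiemannDictionary` prove «`IsArchSmooth` + killed by `𝔭₋` ⇒ holomorphic» and list as NOT THERE the
converse regularity «holomorphic ⇒ `IsArchSmooth`».  This file proves it, through the MATRIX-CHART CLASS: a function `φ : U(2,1) → ℂ` of the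
form `φ = Ψ ∘ mat` with `Ψ : M₃(ℂ) → ℂ` real-`C^∞` on an open `Ω ⊇ mat(U(2,1))`.
* §1 `contDiff_exp_mat`, `mat_mul_expMem` — the exponential slice `Y ↦ mat (g · exp Y) = mat g · e^Y` is real-smooth on `𝔲(2,1)`;
  `isArchSmooth_comp_mat` — every `Ψ ∘ mat` of the class is smooth in the archimedean variable (`IsArchSmooth`); `continuous_comp_mat`;
  `lieDeriv_comp_mat_apply` — its Lie derivative along `X ∈ 𝔲(2,1)` is `(m ↦ DΨ(m)(m·X)) ∘ mat`, again of the class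
  (`contDiffOn_fderiv_apply_mul`); hence (`exists_iterLieDeriv_comp_mat_eq`) every ITERATED Lie derivative `X₁ ⋯ Xₙ (Ψ ∘ mat)` is of the class,
  so `IsArchSmooth` (`isArchSmooth_iterLieDeriv_comp_mat`) and CONTINUOUS on `U(2,1)` (`continuous_iterLieDeriv_comp_mat`) [BorelJacquet1979, §1.5].
* §2 the cotangent group function `u ↦ ᵗJac(u, x₀) · F(u · x₀)` of a HOLOMORPHIC `F : 𝔹² → ℂ²` is of the class (`exists_chart_toGroupFun_cotangent`:
  `Jac(u, x₀)` and `u · x₀` are rational functions of the entries of `mat u` with denominator `(mat u)₂₂ ≠ 0`, and `F` is real-`C^∞` on the open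
  ball by the `C^∞` half of Osgood's lemma ★ `Literature.Analysis.Complex.SCV.contDiffOn_infty`); whence `isArchSmooth_toGroupFun_of_mem_holomorphic`
  (the converse promised in ★ `UnitaryBallLieDerivative`), `isArchSmooth_iterLieDeriv_toGroupFun_of_mem_holomorphic`,
  `continuous_iterLieDeriv_toGroupFun_of_mem_holomorphic` [Borel1997, §5.14]; [Chirka1989, A1.1].

## References
* [BorelJacquet1979] A. Borel, H. Jacquet, Corvallis PSPM 33.1, §1.1, §1.5 (smooth vectors, Lie derivatives through right translation).
* [Borel1997] A. Borel, *Automorphic forms on SL₂(ℝ)*, §5.14 (forms of a given `K`-type as functions on the group; holomorphy).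
* [Chirka1989] E. M. Chirka, *Complex Analytic Sets* (1989), Appendix A1.1 (holomorphic functions in `ℂⁿ` are `C^∞`; W. F. Osgood, Math. Ann. 52 (1899)).
* Tree: ★ `ShimuraVarieties/UnitaryBallLieDerivative` (`u21Group`, `lieDeriv_liePMat_apply`), `UnitaryBallCauchyRiemann`, `UnitaryBallAutomorphicForms`
  (`holomorphic`, `extend`, `cotangentCocycle`), ★ `ComplexHyperbolic/UnitBallU21` (`mat`, `W3`, `Jac`), ★ `Analysis/Complex/SeveralVariables`,
  ★ `Automorphic/ArchimedeanCalculus` (`IsArchSmooth`, `lieDeriv`, `iterLieDeriv`), `RealMatrixGroups` (`expMem`).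
-/

set_option autoImplicit false

-- the mandated namespace has the single-problem summit's repeated segment (`HodgeConjecture.HodgeConjecture`)
set_option linter.dupNamespace false

noncomputable section

open scoped Matrix MatrixGroups Matrix.Norms.Operator Topology ContDiff
open Literature.Geometry.ComplexHyperbolic Literature.Geometry.ComplexHyperbolic.BallModel
open Literature.NumberTheory.Automorphic Literature.NumberTheory.Automorphic.AutomorphyFactor
open Literature.AlgebraicGeometry.ShimuraVarieties Literature.AlgebraicGeometry.ShimuraVarieties.BallForms

namespace Summit.HodgeConjecture.HodgeConjecture.Cruxes.H413.F0P2aL2bMatrixChartSmooth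

/-! ## §1 The matrix-chart class `Ψ ∘ mat` on `U(2,1)`: smooth in the archimedean variable, continuous, Lie-stable -/

/-- `exp` on `M₃(ℂ)` is real-smooth (it is real-analytic, `NormedSpace.exp_analytic`). Knapp, 0.§2. [folklore] -/
theorem contDiff_exp_mat {n : WithTop ℕ∞} : ContDiff ℝ n fun Y : Matrix (Fin 3) (Fin 3) ℂ => NormedSpace.exp Y :=
  contDiff_iff_contDiffAt.2 fun Y => by
    have h : AnalyticAt ℝ (NormedSpace.exp : Matrix (Fin 3) (Fin 3) ℂ → Matrix (Fin 3) (Fin 3) ℂ) Y := NormedSpace.exp_analytic Y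
    exact h.contDiffAt

/-- The exponential slice in matrix coordinates: `mat (g · exp Y) = mat g · e^Y` for `Y ∈ 𝔲(2,1)` (the section `ι = id` is typed
`u21Group.carrier →* U21`, the shape inside `IsArchSmooth` / `lieDeriv`). [folklore] -/
theorem mat_mul_expMem (g : U21) (Y : u21Group.lie) :
    mat (g * @DFunLike.coe (u21Group.carrier →* U21) u21Group.carrier (fun _ => U21) MonoidHom.instFunLike (MonoidHom.id U21)
      (u21Group.expMem Y)) = mat g * NormedSpace.exp (Y : Matrix (Fin 3) (Fin 3) ℂ) := by
  rw [mat_mul]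
  rfl

/-- The `(i,j)` entry `M₃(ℂ) → ℂ` is real-smooth (a continuous real-linear map). [folklore] -/
theorem contDiff_entry (i j : Fin 3) {n : WithTop ℕ∞} : ContDiff ℝ n fun m : Matrix (Fin 3) (Fin 3) ℂ => m i j :=
  (LinearMap.toContinuousLinearMap (Matrix.entryLinearMap ℝ ℂ i j)).contDiff

section Chart

variable {Ω : Set (Matrix (Fin 3) (Fin 3) ℂ)} {Ψ : Matrix (Fin 3) (Fin 3) ℂ → ℂ}

/-- **Functions of the matrix-chart class are smooth in the archimedean variable**: if `Ψ` is real-`C^∞` on a set `Ω` containing `mat(U(2,1))`,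
then `u ↦ Ψ (mat u)` is `IsArchSmooth` for `U(2,1)` (`Y ↦ Ψ (mat g · e^Y)` is a composite of smooth maps). [cite: BorelJacquet1979, §1.1] -/
theorem isArchSmooth_comp_mat (hU : ∀ u : U21, mat u ∈ Ω) (hΨ : ContDiffOn ℝ ∞ Ψ Ω) :
    IsArchSmooth (H := u21Group) (MonoidHom.id U21) fun u => Ψ (mat u) := by
  intro g
  refine hΨ.comp_contDiff ?_ fun X => hU _
  -- the inner map `X ↦ mat (g · exp X) = mat g · e^X` is smooth
  simp only [mat_mul_expMem]
  refine (contDiff_const.mul contDiff_exp_mat).comp ?_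
  -- the inclusion `𝔲(2,1) ↪ M₃(ℂ)` as a continuous real-linear map (the Lie ring structure on `M₃(ℂ)` is Mathlib's non-instance
  -- `LieRing.ofAssociativeRing`, supplied explicitly)
  exact (Submodule.subtypeL (@LieSubalgebra.toSubmodule ℝ (Matrix (Fin 3) (Fin 3) ℂ) _ LieRing.ofAssociativeRing _ u21Group.lie)).contDiff

/-- Functions of the matrix-chart class are continuous on `U(2,1)`. [folklore] -/
theorem continuous_comp_mat (hU : ∀ u : U21, mat u ∈ Ω) (hΨ : ContinuousOn Ψ Ω) : Continuous fun u : U21 => Ψ (mat u) :=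
  hΨ.comp_continuous continuous_mat hU

/-- The exponential curve `t ↦ A · e^{tX}` has derivative `A · X` at `t = 0`. Knapp, 0.§2. [folklore] -/
theorem hasDerivAt_mul_exp_smul (A X : Matrix (Fin 3) (Fin 3) ℂ) :
    HasDerivAt (fun t : ℝ => A * NormedSpace.exp (t • X)) (A * X) 0 := by
  have h := (hasDerivAt_exp_smul_const (𝕂 := ℝ) X (0 : ℝ)).const_mul A
  simp only [zero_smul, NormedSpace.exp_zero, one_mul] at h
  exact h

/-- **The Lie derivative of a chart-class function**: for `Ω` OPEN, `X ∈ 𝔲(2,1)` and `u ∈ U(2,1)`,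
`(X (Ψ ∘ mat))(u) = d/dt Ψ(mat u · e^{tX})|₀ = DΨ(mat u)(mat u · X)`. [cite: BorelJacquet1979, §1.5] -/
theorem lieDeriv_comp_mat_apply (hΩ : IsOpen Ω) (hU : ∀ u : U21, mat u ∈ Ω) (hΨ : ContDiffOn ℝ ∞ Ψ Ω) (X : u21Group.lie) (u : U21) :
    lieDeriv (MonoidHom.id U21) X (fun v => Ψ (mat v)) u = fderiv ℝ Ψ (mat u) (mat u * (X : Matrix (Fin 3) (Fin 3) ℂ)) := by
  have hd : DifferentiableAt ℝ Ψ (mat u) :=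
    (hΨ.contDiffAt (hΩ.mem_nhds (hU u))).differentiableAt (by simp)
  have hcurve : (fun t : ℝ => Ψ (mat (u * (MonoidHom.id U21) (u21Group.expMem (t • X))))) =
      fun t : ℝ => Ψ (mat u * NormedSpace.exp (t • (X : Matrix (Fin 3) (Fin 3) ℂ))) := by
    funext t
    rw [MonoidHom.id_apply, mat_mul]
    rfl
  unfold lieDeriv
  show deriv (fun t : ℝ => Ψ (mat (u * (MonoidHom.id U21) (u21Group.expMem (t • X))))) 0 = _
  rw [hcurve]
  exact (hd.hasFDerivAt.comp_hasDerivAt_of_eq (0 : ℝ) (hasDerivAt_mul_exp_smul (mat u) (X : Matrix (Fin 3) (Fin 3) ℂ))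
    (by rw [zero_smul, NormedSpace.exp_zero, mul_one])).deriv

/-- The chart of the Lie derivative, `m ↦ DΨ(m)(m · X)`, is again real-`C^∞` on the open `Ω`. [folklore] -/
theorem contDiffOn_fderiv_apply_mul (hΩ : IsOpen Ω) (hΨ : ContDiffOn ℝ ∞ Ψ Ω) (X : Matrix (Fin 3) (Fin 3) ℂ) :
    ContDiffOn ℝ ∞ (fun m => fderiv ℝ Ψ m (m * X)) Ω :=
  (hΨ.fderiv_of_isOpen hΩ (by simp)).clm_apply (contDiffOn_id.mul contDiffOn_const)

/-- **The matrix-chart class is stable under iterated Lie derivatives**: for `Ω` open, every `X₁ ⋯ Xₙ (Ψ ∘ mat)` is `Ψ_w ∘ mat` with `Ψ_w`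
real-`C^∞` on `Ω`. [cite: BorelJacquet1979, §1.5] -/
theorem exists_iterLieDeriv_comp_mat_eq (hΩ : IsOpen Ω) (hU : ∀ u : U21, mat u ∈ Ω) (hΨ : ContDiffOn ℝ ∞ Ψ Ω) (w : List u21Group.lie) :
    ∃ Ψw : Matrix (Fin 3) (Fin 3) ℂ → ℂ, ContDiffOn ℝ ∞ Ψw Ω ∧
      iterLieDeriv (MonoidHom.id U21) w (fun v => Ψ (mat v)) = fun v => Ψw (mat v) := by
  induction w with
  | nil => exact ⟨Ψ, hΨ, rfl⟩
  | cons X w ih =>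
    obtain ⟨Ψw, hw, he⟩ := ih
    refine ⟨fun m => fderiv ℝ Ψw m (m * (X : Matrix (Fin 3) (Fin 3) ℂ)), contDiffOn_fderiv_apply_mul hΩ hw _, ?_⟩
    rw [iterLieDeriv_cons, he]
    funext u
    exact lieDeriv_comp_mat_apply hΩ hU hw X u

/-- Iterated Lie derivatives of a chart-class function are smooth in the archimedean variable. [cite: BorelJacquet1979, §1.5] -/
theorem isArchSmooth_iterLieDeriv_comp_mat (hΩ : IsOpen Ω) (hU : ∀ u : U21, mat u ∈ Ω) (hΨ : ContDiffOn ℝ ∞ Ψ Ω)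
    (w : List u21Group.lie) :
    IsArchSmooth (H := u21Group) (MonoidHom.id U21) (iterLieDeriv (MonoidHom.id U21) w fun v => Ψ (mat v)) := by
  obtain ⟨Ψw, hw, he⟩ := exists_iterLieDeriv_comp_mat_eq hΩ hU hΨ w
  rw [he]
  exact isArchSmooth_comp_mat hU hw

/-- Iterated Lie derivatives of a chart-class function are CONTINUOUS on `U(2,1)`. [cite: BorelJacquet1979, §1.5] -/
theorem continuous_iterLieDeriv_comp_mat (hΩ : IsOpen Ω) (hU : ∀ u : U21, mat u ∈ Ω) (hΨ : ContDiffOn ℝ ∞ Ψ Ω)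
    (w : List u21Group.lie) :
    Continuous (iterLieDeriv (MonoidHom.id U21) w fun v => Ψ (mat v)) := by
  obtain ⟨Ψw, hw, he⟩ := exists_iterLieDeriv_comp_mat_eq hΩ hU hΨ w
  rw [he]
  exact continuous_comp_mat hU hw.continuousOn

end Chart

/-! ## §2 The cotangent group function of a holomorphic ball function is of the matrix-chart class -/

/-- Coordinates of the cotangent group function: `(ᵗJac(u,x₀) · F(u·x₀))_k = ∑ⱼ Jac(u,x₀)_{jk} F(u·x₀)_j`. [folklore] -/
theorem toGroupFun_cotangent_apply (F : Ball → (Fin 2 → ℂ)) (u : U21) (k : Fin 2) :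
    toGroupFun cotangentCocycle x₀ F u k = ∑ j : Fin 2, Jac u x₀ j k * F (u • x₀) j := by
  rw [toGroupFun_apply, cotangentCocycle_apply]
  simp only [Matrix.mulVec, dotProduct, Matrix.transpose_apply]

/-- The Jacobian at the base point in matrix coordinates: `Jac(u, x₀)_{ij} = (m_{ij} m₂₂ − m_{i2} m_{2j}) / m₂₂²`, `m = mat u`. [folklore] -/
theorem Jac_x₀_apply (u : U21) (i j : Fin 2) :
    Jac u x₀ i j = (mat u (Fin.castSucc i) (Fin.castSucc j) * mat u 2 2 - mat u (Fin.castSucc i) 2 * mat u 2 (Fin.castSucc j)) /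
      mat u 2 2 ^ 2 := by
  simp only [Jac, Matrix.of_apply, W3_apply, x₀_val, Pi.zero_apply, mul_zero, zero_add]

/-- A holomorphic `ℂ²`-valued function on the ball is real-`C^∞` on the open ball (the `C^∞` half of Osgood's lemma,
★ `SCV.contDiffOn_infty`). [cite: Chirka1989, Appendix A1.1] -/
theorem contDiffOn_real_extend_of_mem_holomorphic {F : Ball → (Fin 2 → ℂ)} (hF : F ∈ holomorphic (Fin 2 → ℂ)) :
    ContDiffOn ℝ ∞ (extend (Fin 2 → ℂ) F) ballSet :=
  (Literature.Analysis.Complex.SCV.contDiffOn_infty hF isOpen_ballSet).restrict_scalars ℝ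

/-- **The cotangent group function of a holomorphic ball function is of the matrix-chart class.**  For `F : 𝔹² → ℂ²` holomorphic and
`k ∈ {0,1}` there are an OPEN `Ω ⊆ M₃(ℂ)` containing `mat(U(2,1))` and a real-`C^∞` `Ψ : Ω → ℂ` with `(ᵗJac(u,x₀) · F(u·x₀))_k = Ψ (mat u)`:
`Ω = {m : m₂₂ ≠ 0, (m₀₂/m₂₂, m₁₂/m₂₂) ∈ 𝔹²}`, `Ψ(m) = ∑ⱼ (m_{jk} m₂₂ − m_{j2} m_{2k}) m₂₂⁻² · F(m₀₂/m₂₂, m₁₂/m₂₂)_j`.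
[cite: Borel1997, §5.14] [cite: Chirka1989, Appendix A1.1] -/
theorem exists_chart_toGroupFun_cotangent {F : Ball → (Fin 2 → ℂ)} (hF : F ∈ holomorphic (Fin 2 → ℂ)) (k : Fin 2) :
    ∃ (Ω : Set (Matrix (Fin 3) (Fin 3) ℂ)) (Ψ : Matrix (Fin 3) (Fin 3) ℂ → ℂ), IsOpen Ω ∧ (∀ u : U21, mat u ∈ Ω) ∧ ContDiffOn ℝ ∞ Ψ Ω ∧
      ∀ u : U21, toGroupFun cotangentCocycle x₀ F u k = Ψ (mat u) := by
  -- the orbit chart `a(m) = (m₀₂/m₂₂, m₁₂/m₂₂)` and the domain `Ω`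
  let a : Matrix (Fin 3) (Fin 3) ℂ → (Fin 2 → ℂ) := fun m i => m (Fin.castSucc i) 2 / m 2 2
  let Ω₀ : Set (Matrix (Fin 3) (Fin 3) ℂ) := {m | m 2 2 ≠ 0}
  let Ω : Set (Matrix (Fin 3) (Fin 3) ℂ) := Ω₀ ∩ a ⁻¹' ballSet
  have hΩ₀ : IsOpen Ω₀ := isOpen_ne_fun (contDiff_entry 2 2 (n := 0)).continuous continuous_const
  have hinv : ContDiffOn ℝ ∞ (fun m : Matrix (Fin 3) (Fin 3) ℂ => (m 2 2)⁻¹) Ω₀ :=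
    (contDiff_entry 2 2).contDiffOn.inv fun m hm => hm
  have ha : ContDiffOn ℝ ∞ a Ω₀ :=
    contDiffOn_pi' fun i => by
      simp only [a, div_eq_mul_inv]
      exact (contDiff_entry _ 2).contDiffOn.mul hinv
  have hΩ : IsOpen Ω := ha.continuousOn.isOpen_inter_preimage hΩ₀ isOpen_ballSet
  -- the chart `Ψ`
  let Ψ : Matrix (Fin 3) (Fin 3) ℂ → ℂ := fun m =>
    ∑ j : Fin 2, (m (Fin.castSucc j) (Fin.castSucc k) * m 2 2 - m (Fin.castSucc j) 2 * m 2 (Fin.castSucc k)) / m 2 2 ^ 2 *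
      extend (Fin 2 → ℂ) F (a m) j
  have hΨ : ContDiffOn ℝ ∞ Ψ Ω := by
    refine ContDiffOn.sum fun j _ => ContDiffOn.mul ?_ ?_
    · simp only [div_eq_mul_inv]
      refine ContDiffOn.mul (((contDiff_entry _ _).mul (contDiff_entry 2 2)).sub
        ((contDiff_entry _ 2).mul (contDiff_entry 2 _))).contDiffOn ?_
      have h2 : ContDiffOn ℝ ∞ (fun m : Matrix (Fin 3) (Fin 3) ℂ => (m 2 2 ^ 2)⁻¹) Ω₀ :=
        ((contDiff_entry 2 2).pow 2).contDiffOn.inv fun m hm => pow_ne_zero 2 hm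
      exact h2.mono Set.inter_subset_left
    · have hc : ContDiffOn ℝ ∞ (fun m => extend (Fin 2 → ℂ) F (a m)) Ω :=
        (contDiffOn_real_extend_of_mem_holomorphic hF).comp (ha.mono Set.inter_subset_left) fun m hm => hm.2
      exact ((ContinuousLinearMap.proj (R := ℝ) (φ := fun _ : Fin 2 => ℂ) j).contDiff.comp_contDiffOn hc)
  -- `mat u ∈ Ω` and the identification
  have hact : ∀ u : U21, a (mat u) = (u • x₀).1 := fun u => funext fun i => (smul_x₀_val u i).symm
  have hU : ∀ u : U21, mat u ∈ Ω := fun u =>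
    ⟨mat_two_two_ne_zero u, by
      show a (mat u) ∈ ballSet
      rw [hact u]
      exact coe_mem_ballSet _⟩
  refine ⟨Ω, Ψ, hΩ, hU, hΨ, fun u => ?_⟩
  rw [toGroupFun_cotangent_apply]
  refine Finset.sum_congr rfl fun j _ => ?_
  rw [Jac_x₀_apply, hact u, extend_apply_coe]

/-- **The cotangent group function of a HOLOMORPHIC ball function is smooth in the archimedean variable** — the converse regularity to
★ `BallForms.mem_holomorphic_of_isArchSmooth`: for `F ∈ holomorphic (Fin 2 → ℂ)` every coordinate of `u ↦ ᵗJac(u,x₀) · F(u·x₀)` is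
`IsArchSmooth` for `U(2,1)`. [cite: Borel1997, §5.14] [cite: BorelJacquet1979, §1.1] -/
theorem isArchSmooth_toGroupFun_of_mem_holomorphic {F : Ball → (Fin 2 → ℂ)} (hF : F ∈ holomorphic (Fin 2 → ℂ)) (k : Fin 2) :
    IsArchSmooth (H := u21Group) (MonoidHom.id U21) fun u => toGroupFun cotangentCocycle x₀ F u k := by
  obtain ⟨Ω, Ψ, -, hU, hΨ, heq⟩ := exists_chart_toGroupFun_cotangent hF k
  rw [show (fun u => toGroupFun cotangentCocycle x₀ F u k) = fun u => Ψ (mat u) from funext heq]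
  exact isArchSmooth_comp_mat hU hΨ

/-- **All iterated Lie derivatives `X₁ ⋯ Xₙ` (`Xᵢ ∈ 𝔲(2,1)`) of the coordinates of the cotangent group function of a holomorphic ball function
are smooth in the archimedean variable.** [cite: BorelJacquet1979, §1.5] [cite: Borel1997, §5.14] -/
theorem isArchSmooth_iterLieDeriv_toGroupFun_of_mem_holomorphic {F : Ball → (Fin 2 → ℂ)} (hF : F ∈ holomorphic (Fin 2 → ℂ))
    (k : Fin 2) (w : List u21Group.lie) :
    IsArchSmooth (H := u21Group) (MonoidHom.id U21)
      (iterLieDeriv (MonoidHom.id U21) w fun u => toGroupFun cotangentCocycle x₀ F u k) := by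
  obtain ⟨Ω, Ψ, hΩ, hU, hΨ, heq⟩ := exists_chart_toGroupFun_cotangent hF k
  rw [show (fun u => toGroupFun cotangentCocycle x₀ F u k) = fun u => Ψ (mat u) from funext heq]
  exact isArchSmooth_iterLieDeriv_comp_mat hΩ hU hΨ w

/-- **All iterated Lie derivatives of the coordinates of the cotangent group function of a holomorphic ball function are CONTINUOUS on
`U(2,1)`** (in particular — `w = []` — the group function itself). [cite: BorelJacquet1979, §1.5] [cite: Borel1997, §5.14] -/
theorem continuous_iterLieDeriv_toGroupFun_of_mem_holomorphic {F : Ball → (Fin 2 → ℂ)} (hF : F ∈ holomorphic (Fin 2 → ℂ))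
    (k : Fin 2) (w : List u21Group.lie) :
    Continuous (iterLieDeriv (MonoidHom.id U21) w fun u => toGroupFun cotangentCocycle x₀ F u k) := by
  obtain ⟨Ω, Ψ, hΩ, hU, hΨ, heq⟩ := exists_chart_toGroupFun_cotangent hF k
  rw [show (fun u => toGroupFun cotangentCocycle x₀ F u k) = fun u => Ψ (mat u) from funext heq]
  exact continuous_iterLieDeriv_comp_mat hΩ hU hΨ w

end Summit.HodgeConjecture.HodgeConjecture.Cruxes.H413.F0P2aL2bMatrixChartSmooth

end
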